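import Summits.AtomisticToContinuum.HydrodynamicLimit.Theorems.OneFlightGossipEngineCollisionActivityTailsEndpointTails
import Literature.Analysis.FluidPDE.HardSphereCollisionRecord
import HarnessLib

/-!
# `TransferActivityTails` (stmt-AtomisticToContinuum-16624), line `IdeatorOneSketch`: stub `stub_transferLeHitWeight`

Helper file (`--supports stmt-AtomisticToContinuum-16624`) for the crux
`Summit.AtomisticToContinuum.HydrodynamicLimit.Theses.TwoClocks.TransferActivityTails`, skeleton line
`IdeatorOneSketch` (idea `tagged-count-chernoff`), registered stub `stub_transferLeHitWeight : TransferLeHitWeight`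
(the per-record KINEMATICS).

For a record `HardSphereCollisionRecord.ofConfig G ε z t k l` read off a configuration, the pre-collisional
velocities `(v, w)` are the elastic reflection of the post-collisional ones `(a, b) = ((z k).2, (z l).2)`.
Momentum conservation `v + w = a + b` and energy conservation `‖v‖² + ‖w‖² = ‖a‖² + ‖b‖²` alone give, for the
jump `δ = a − v` of the first partner, the identity `‖δ‖² = ⟪w − v, δ⟫` (`norm_sq_sub_eq_inner_of_conservation`),
whence `‖δ‖ ≤ ‖v‖ + ‖w‖` and `‖a‖² − ‖v‖² = ⟪v + w, δ⟫`, and finally the domination of the crux's transfer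
weight by the energy-marked, impulse-truncated hit weight,
`‖δ‖ + |‖a‖² − ‖v‖²| / 2 ≤ 2 (1 + ‖v‖² + ‖w‖²) · min 1 ‖δ‖` (`transfer_le_hit`).

References: C. Cercignani, R. Illner, M. Pulvirenti, *The Mathematical Theory of Dilute Gases* (1994) §4.2
(elastic collision law, conservation of momentum and energy); the inequality itself is elementary (Cauchy–Schwarz).
-/

noncomputable section

open MeasureTheory Set Filter Topology
open scoped ENNReal InnerProductSpace BigOperators

namespace Summit.AtomisticToContinuum.HydrodynamicLimit.Theorems.TransferActivityTailsTransferLeHitWeight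

open Literature.MathematicalPhysics.KineticTheory Literature.Analysis.FluidPDE
open Summit.AtomisticToContinuum.HydrodynamicLimit.Theorems.CollisionActivityTailsEndpointTails
  (Flow Cfg window tailFn tailFn_of_lt tailFn_of_le measurable_tailFn ae_mem_good_localGibbsLaw)

/-! ## §0 Vocabulary of the line (verbatim from the skeleton `IdeatorOneSketch`) -/

/-- Collision records of `N + 1` spheres on `𝕋³` (registered stub signature of line IdeatorOneSketch, crux
TransferActivityTails (stmt-AtomisticToContinuum-16624) — route-internal, not a cited fact). -/
abbrev Rec (N : ℕ) : Type := HardSphereCollisionRecord (Fin 3) T3 (N + 1)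

/-- The crux's per-record TRANSFER weight of particle `i` (registered stub signature of line IdeatorOneSketch, crux
TransferActivityTails (stmt-AtomisticToContinuum-16624) — route-internal, not a cited fact). -/
def transferWeight {N : ℕ} (i : Fin (N + 1)) (c : Rec N) : ℝ :=
  if c.fst = i then ‖c.postVel.1 - c.preVel.1‖ + |‖c.postVel.1‖ ^ 2 - ‖c.preVel.1‖ ^ 2| / 2 else 0

/-- The energy-marked, impulse-truncated hit weight of particle `i` (registered stub signature of line
IdeatorOneSketch, crux TransferActivityTails (stmt-AtomisticToContinuum-16624) — route-internal, not a cited fact). -/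
def hitWeight {N : ℕ} (i : Fin (N + 1)) (c : Rec N) : ℝ :=
  if c.fst = i then 2 * (1 + ‖c.preVel.1‖ ^ 2 + ‖c.preVel.2‖ ^ 2) * min 1 ‖c.postVel.1 - c.preVel.1‖ else 0

/-- Stub 1 of the line, per-record kinematics: transfer weight ≤ hit weight on every record read off a
configuration (registered stub signature of line IdeatorOneSketch, crux TransferActivityTails
(stmt-AtomisticToContinuum-16624) — route-internal, not a cited fact). -/
def TransferLeHitWeight : Prop :=
  ∀ (N : ℕ) (ε : ℝ) (z : Cfg N) (t : ℝ) (i k l : Fin (N + 1)),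
    transferWeight i (HardSphereCollisionRecord.ofConfig (Torus.geometry (Fin 3)) ε z t k l) ≤
      hitWeight i (HardSphereCollisionRecord.ofConfig (Torus.geometry (Fin 3)) ε z t k l)

/-! ## §1 Inner-product-space kinematics -/

section Kinematics

variable {E : Type*} [NormedAddCommGroup E] [InnerProductSpace ℝ E]

/-- **The key identity from the conservation laws.** If `v + w = a + b` (momentum) and
`‖v‖² + ‖w‖² = ‖a‖² + ‖b‖²` (energy), then the jump `δ = a − v` of the first partner satisfies
`‖δ‖² = ⟪w − v, δ⟫` (indeed `b = w − δ`, and expanding `‖v + δ‖² + ‖w − δ‖² = ‖v‖² + ‖w‖²`). -/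
theorem norm_sq_sub_eq_inner_of_conservation {a b v w : E} (hm : v + w = a + b)
    (he : ‖v‖ ^ 2 + ‖w‖ ^ 2 = ‖a‖ ^ 2 + ‖b‖ ^ 2) : ‖a - v‖ ^ 2 = ⟪w - v, a - v⟫_ℝ := by
  have hb : b = w - (a - v) := by
    calc b = a + b - a := (add_sub_cancel_left a b).symm
      _ = v + w - a := by rw [hm]
      _ = w - (a - v) := by abel
  have ha : ‖a‖ ^ 2 = ‖v‖ ^ 2 + 2 * ⟪v, a - v⟫_ℝ + ‖a - v‖ ^ 2 := by
    rw [← norm_add_sq_real, add_sub_cancel]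
  rw [hb, norm_sub_sq_real, ha] at he
  rw [inner_sub_left]
  linarith

/-- From the key identity: the jump is at most the sum of the two speeds, `‖δ‖ ≤ ‖v‖ + ‖w‖`
(Cauchy–Schwarz: `‖δ‖² = ⟪w − v, δ⟫ ≤ ‖w − v‖ ‖δ‖`). -/
theorem norm_sub_le_of_key {a v w : E} (h : ‖a - v‖ ^ 2 = ⟪w - v, a - v⟫_ℝ) :
    ‖a - v‖ ≤ ‖v‖ + ‖w‖ := by
  have hcs : ‖a - v‖ * ‖a - v‖ ≤ (‖v‖ + ‖w‖) * ‖a - v‖ := by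
    calc ‖a - v‖ * ‖a - v‖ = ⟪w - v, a - v⟫_ℝ := by rw [← sq, h]
      _ ≤ ‖w - v‖ * ‖a - v‖ := real_inner_le_norm _ _
      _ ≤ (‖v‖ + ‖w‖) * ‖a - v‖ := by
          refine mul_le_mul_of_nonneg_right ?_ (norm_nonneg _)
          exact (norm_sub_le _ _).trans (add_comm ‖w‖ ‖v‖).le
  by_cases h0 : ‖a - v‖ = 0
  · rw [h0]
    positivity
  · exact le_of_mul_le_mul_right hcs ((norm_nonneg _).lt_of_ne (Ne.symm h0))

/-- From the key identity: the energy transferred to the first partner is `‖a‖² − ‖v‖² = ⟪v + w, δ⟫`. -/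
theorem norm_sq_sub_norm_sq_eq_of_key {a v w : E} (h : ‖a - v‖ ^ 2 = ⟪w - v, a - v⟫_ℝ) :
    ‖a‖ ^ 2 - ‖v‖ ^ 2 = ⟪v + w, a - v⟫_ℝ := by
  have ha : ‖a‖ ^ 2 = ‖v‖ ^ 2 + 2 * ⟪v, a - v⟫_ℝ + ‖a - v‖ ^ 2 := by
    rw [← norm_add_sq_real, add_sub_cancel]
  rw [inner_sub_left] at h
  rw [inner_add_left]
  linarith

/-- **Transfer weight ≤ hit weight** (pure inner-product-space form). Under the key identity
`‖a − v‖² = ⟪w − v, a − v⟫`: `‖a − v‖ + |‖a‖² − ‖v‖²| / 2 ≤ 2 (1 + ‖v‖² + ‖w‖²) · min 1 ‖a − v‖`.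
With `d = ‖a − v‖`, `S = ‖v‖ + ‖w‖`, `Q = ‖v‖² + ‖w‖²`: the left side is `≤ d (1 + S/2)`, `d ≤ S`,
`S ≤ 1 + Q/2`, `S² ≤ 2Q`; if `d ≤ 1` then `d (1 + S/2) ≤ 2 (1 + Q) d`, else `d (1 + S/2) ≤ S + S²/2 ≤ 2 (1 + Q)`. -/
theorem transfer_le_hit (a v w : E) (h : ‖a - v‖ ^ 2 = ⟪w - v, a - v⟫_ℝ) :
    ‖a - v‖ + |‖a‖ ^ 2 - ‖v‖ ^ 2| / 2 ≤ 2 * (1 + ‖v‖ ^ 2 + ‖w‖ ^ 2) * min 1 ‖a - v‖ := by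
  have hd : ‖a - v‖ ≤ ‖v‖ + ‖w‖ := norm_sub_le_of_key h
  have hA : |‖a‖ ^ 2 - ‖v‖ ^ 2| ≤ (‖v‖ + ‖w‖) * ‖a - v‖ := by
    rw [norm_sq_sub_norm_sq_eq_of_key h]
    exact (abs_real_inner_le_norm _ _).trans (mul_le_mul_of_nonneg_right (norm_add_le _ _) (norm_nonneg _))
  have hv := norm_nonneg v
  have hw := norm_nonneg w
  have hδ := norm_nonneg (a - v)
  -- `S ≤ 1 + Q/2` and `S² ≤ 2 Q`
  have hS : ‖v‖ + ‖w‖ ≤ 1 + (‖v‖ ^ 2 + ‖w‖ ^ 2) / 2 := by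
    nlinarith [sq_nonneg (‖v‖ - 1), sq_nonneg (‖w‖ - 1)]
  have hSS : (‖v‖ + ‖w‖) * (‖v‖ + ‖w‖) ≤ 2 * (‖v‖ ^ 2 + ‖w‖ ^ 2) := by
    nlinarith [sq_nonneg (‖v‖ - ‖w‖)]
  rcases le_total ‖a - v‖ 1 with h1 | h1
  · -- small jump: `min 1 d = d`
    rw [min_eq_right h1]
    have hSd : (‖v‖ + ‖w‖) * ‖a - v‖ ≤ (1 + (‖v‖ ^ 2 + ‖w‖ ^ 2) / 2) * ‖a - v‖ :=
      mul_le_mul_of_nonneg_right hS hδ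
    nlinarith [mul_nonneg (add_nonneg (sq_nonneg ‖v‖) (sq_nonneg ‖w‖)) hδ]
  · -- large jump: `min 1 d = 1`
    rw [min_eq_left h1, mul_one]
    have hSd : (‖v‖ + ‖w‖) * ‖a - v‖ ≤ (‖v‖ + ‖w‖) * (‖v‖ + ‖w‖) :=
      mul_le_mul_of_nonneg_left hd (add_nonneg hv hw)
    nlinarith [add_nonneg (sq_nonneg ‖v‖) (sq_nonneg ‖w‖)]

/-- **Transfer weight ≤ hit weight for an elastic reflection.** For the reflection law `reflectVel n` with
pre-collisional pair `(v, w) = reflectVel n (a, b)` and post-collisional pair `(a, b)`: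
`‖a − v‖ + |‖a‖² − ‖v‖²| / 2 ≤ 2 (1 + ‖v‖² + ‖w‖²) · min 1 ‖a − v‖`. -/
theorem transfer_le_hit_reflectVel (n : E) (p : E × E) :
    ‖p.1 - (reflectVel n p).1‖ + |‖p.1‖ ^ 2 - ‖(reflectVel n p).1‖ ^ 2| / 2 ≤
      2 * (1 + ‖(reflectVel n p).1‖ ^ 2 + ‖(reflectVel n p).2‖ ^ 2) * min 1 ‖p.1 - (reflectVel n p).1‖ :=
  transfer_le_hit p.1 (reflectVel n p).1 (reflectVel n p).2
    (norm_sq_sub_eq_inner_of_conservation (reflectVel_fst_add_reflectVel_snd n p)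
      (norm_sq_reflectVel_fst_add_norm_sq_reflectVel_snd n p))

end Kinematics

/-! ## §2 The registered stub -/

/-- Stub 1 (registered): per-record kinematics — on every record `ofConfig (Torus.geometry (Fin 3)) ε z t k l`
the transfer weight of any particle `i` is at most its hit weight (both vanish unless `k = i`; for `k = i` this is
`transfer_le_hit_reflectVel` for the pair `((z k).2, (z l).2)` reflected along the separation vector). -/
theorem stub_transferLeHitWeight : TransferLeHitWeight := by
  intro N ε z t i k l
  unfold transferWeight hitWeight
  simp only [HardSphereCollisionRecord.ofConfig_fst, HardSphereCollisionRecord.ofConfig_preVel,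
    HardSphereCollisionRecord.ofConfig_postVel]
  split_ifs
  · exact transfer_le_hit_reflectVel ((Torus.geometry (Fin 3)).sepVec (z k).1 (z l).1) ((z k).2, (z l).2)
  · exact le_rfl

end Summit.AtomisticToContinuum.HydrodynamicLimit.Theorems.TransferActivityTailsTransferLeHitWeight

end
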